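import Summits.HodgeConjecture.HodgeConjecture.Theorems.F0P6aStubFROBRoofLegsKernelRows
import HarnessLib

/-!
# `F0P6aStubFROBRoofLegs` — ★ RE-HOME of `Lines/F0_P6a_StubFROBRoofLegs.lean` (tree sha16 082e2a3dbd17c2a8), PART 2 of 2 — tree lines :313–:407 (LAST part: the module the `Lines/` shim and consumers import; it transitively carries parts 1–1).

See PART 1 `Theorems/F0P6aStubFROBRoofLegsKernelRows.lean` for the full ★ re-home header and the original module docstring (verbatim there).  Same namespace (every fully-qualified name unchanged);
the scopes open at the cut (`noncomputable section` ∕ `namespace` ∕ `section`s) are re-opened below with their `variable` ∕ `open` ∕ `set_option` ∕ `omit` ∕ `include` ∕ `universe` lines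
replayed verbatim from the tree, in order; the code after the replay block is the tree bytes :313–:407, untouched.  HC_CM is proved only modulo the 7 printed citations (2 remaining: hLiu418 = stmt-HodgeConjecture-24832, h413 = stmt-HodgeConjecture-24833) until rung 0 closes; a re-home is count-neutral.
-/

-- ── replay of the scopes open at tree line :313 (verbatim) ──
set_option autoImplicit false
noncomputable section
namespace Summit.HodgeConjecture.HodgeConjecture.Cruxes.HLiu418.F0P6aStubFROBRoofLegs
set_option linter.dupNamespace false  -- `Summit.HodgeConjecture.HodgeConjecture.…` BY DESIGN (D-0017)
open CategoryTheory CategoryTheory.Limits NumberField IsDedekindDomain MulAction AlgebraicGeometry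
open scoped Matrix Pointwise MonObj
open Literature.NumberTheory.GaloisRepresentations
open Literature.NumberTheory.Automorphic Literature.NumberTheory.Automorphic.UnitaryGroup
open Literature.AlgebraicGeometry.ShimuraVarieties.UnitaryCanonicalModel
open Literature.NumberTheory.Automorphic.Liu2021.AppendixC
open Literature.AlgebraicGeometry.Motives (AlgPoints IntegralModel SchemeOver thickening thickeningLift specOver relFrobeniusOver frobSpec)
open Literature.NumberTheory.DiophantineGeometry (geomResidueField specialFibreFunctor specResidueField)
open Literature.AlgebraicGeometry.RelativeSpec (ActionOver)
open Literature.NumberTheory.EllipticCurves (genericFibre specGenericPoint)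
open Literature.AlgebraicGeometry.AbelianSchemes Literature.AlgebraicGeometry.AbelianSchemes.AbelianSchemeOver
open Summit.HodgeConjecture.HodgeConjecture.Cruxes.HLiu418.F0P6aModuliDatumDefs
open Summit.HodgeConjecture.HodgeConjecture.Cruxes.HLiu418.F0P6aRGDAssembly
open Summit.HodgeConjecture.HodgeConjecture.Cruxes.HLiu418.F0P6aDatumOfInputs
set_option backward.isDefEq.respectTransparency false
variable {F : Type} [Field F] [NumberField F] [IsCMField F] {ι₁ : F →+* ℂ}
    {Jstar : Matrix (Fin 2) (Fin 2) F}
    {K₀ : C5.OpenCompactSubgroup ↥(finAdelic ↥(maximalRealSubfield F) F (IsCMField.complexConj F) 2 Jstar)}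
    {S : RecordSystemGS F Jstar ι₁ K₀} {hU7ₛ : S.HeckeTranslateDefinedOver}
    {hJ : (Jstar.map (IsCMField.complexConj F))ᵀ = Jstar} {hJu : IsUnit Jstar}
    {Fi : Type} [Field Fi] [Algebra F Fi] {Kc : C5.SmallLevel K₀} {G : Type} [Group G]
    {𝓜 : IntegralModel (𝓞 F) F ((thickening F Fi).obj (S.M.obj Kc))}
    {w : HeightOneSpectrum (𝓞 F)} {hw : (IsCMField.complexConj F) • w ≠ w} {h𝓨 : (𝓜.localise w).IsSmoothProper 1}
    {θ : ActionOver (𝓜.localise w).total.hom ((Fi ≃ₐ[F] Fi) × G)}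
    {e : Fi →ₐ[F] AlgebraicClosure (w.adicCompletion F)}
section KernelRows
open Literature.NumberTheory.DiophantineGeometry
open Literature.AlgebraicGeometry.Motives (extendPoint specValuationSubring specFractionFieldι specRingHomι)
-- ── tree bytes :313–:407 ──

set_option maxHeartbeats 400000 in
/-- (head′) **THE LEGS OF THE DOWNSTAIRS ROOF AT THE D-LINE BINDERS, WITH THE ROOF WITNESSES AND THE KERNEL ROWS** — `roofLegs_of_roofLink`'s binders VERBATIM
(incl. the unit pin `hD`), stated in the `red₀Of` currency like it; for every `y`, `L`: the `RoofLink` subgroup `K` with its line clause, the roof `B, DB, λ_B, q, c` with (r1)–(r5),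
and the reduced leg `q̄` with (r1₀)(r4₀-q)(r5₀-q)(r3₀-q ∀)(K3₀)(K2₀)(K4₀)(FIN₀)(RK₀) — ONE ∃ (W5's `obtain`; `hker`∕`hkerq` := (K2₀) at `𝔭_w * (c•w).asIdeal` fed through (r1);
`rk Γ(Ker q̄) = Nat.card K` := (RK₀) + (r1)). [cite: Liu2021, Prop. D.8 (3) p. 135, pp. 136–138] [cite: RapoportSmithlingZhang2020Diagonal, §4.1 p. 17; §4.3 (4.23) p. 21]
[cite: MumfordAV1970, §23 Thm. 2 (p. 231)] -/
theorem roofLegs_of_roofLink_kerRows (I : RGDInputsAt F ι₁ Jstar K₀ S hU7ₛ hJ hJu Fi Kc G 𝓜 w hw h𝓨 θ e)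
    {m : ℕ} (E' : Matrix (Fin m) (Fin m) (𝓞 F)) (hE' : E' * E' = E') (P : Matrix (Fin m) (Fin 1) (𝓞 F)) (Q : Matrix (Fin 1) (Fin m) (𝓞 F))
    (hP : E' * P = P) (hQ : Q * E' = Q) (hQP : Q * P = Matrix.scalar (Fin 1) (I.pChar : 𝓞 F))
    (hPQ : P * Q = Matrix.scalar (Fin m) (I.pChar : 𝓞 F) * E') (h𝔭 : Ideal.span (Set.range fun k => P k 0) = w.asIdeal)
    (hD : Nonempty ((Scheme.Modules.pullback (DualPair.unitHatSlice I.dual)).obj I.dual.P ≅ SheafOfModules.unit _))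
    (quotΩ : ∀ y, LineOf I y → AlgPoints (S.M.obj Kc) (AlgebraicClosure (w.adicCompletion F))) (hroof : RoofLink I quotΩ) :
    haveI := I.comm
    haveI : IsProper (𝓜.localise w).total.hom := h𝓨.2
    ∀ (y : AlgPoints (S.M.obj Kc) (AlgebraicClosure (w.adicCompletion F))) (L : LineOf I y),
      ∃ K : Subgroup ((fibreΩOf S Kc 𝓜 w e I.univ y).Points (AlgebraicClosure (w.adicCompletion F))),
        (∀ P, P ∈ L.1 ↔ P ∈ K ∧ IsIdealTorsionΩ S Kc 𝓜 w e I.univ I.act y ((IsCMField.complexConj F) • w).asIdeal P) ∧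
        ∃ (B : Literature.AlgebraicGeometry.AbelianSchemes.AbelianSchemeOver (AlgebraicGeometry.Spec (CommRingCat.of (AlgebraicClosure (w.adicCompletion F)))))
          (DB : B.DualPair) (lamB : B.X ⟶ DB.hat.X) (_ : IsMonHom lamB)
          -- J12 INTERFACE PIN (ref1 (g2) e-12): `B̂`'s Poincaré sheaf is normalised along `A × {ε_B̂}` — the unit clause `hD_B` (for a ★ `Polarization` it is ★ `Polarization.nonempty_unitHatSlice_iso`)
          (_ : Nonempty ((AlgebraicGeometry.Scheme.Modules.pullback DB.unitHatSlice).obj DB.P ≅ SheafOfModules.unit _))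
          (q : (schΩOf S Kc 𝓜 w e I.univ y).X ⟶ B.X) (_ : IsMonHom q)
          (c : (schΩOf S Kc 𝓜 w e I.univ (quotΩ y L)).X ⟶ B.X) (_ : IsMonHom c),
          -- (r1) kernel of `q` on `Ω`-points
          (∀ P : (fibreΩOf S Kc 𝓜 w e I.univ y).Points (AlgebraicClosure (w.adicCompletion F)),
              (AlgPoints.map q P : B.toAffine.toAbelianVariety.Points (AlgebraicClosure (w.adicCompletion F))) = 1 ↔ P ∈ K) ∧
          -- (r2) kernel of `c` on `Ω`-points = the `𝔞`-torsion; `c` surjective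
          (∀ P : (fibreΩOf S Kc 𝓜 w e I.univ (quotΩ y L)).Points (AlgebraicClosure (w.adicCompletion F)),
              (AlgPoints.map c P : B.toAffine.toAbelianVariety.Points (AlgebraicClosure (w.adicCompletion F))) = 1 ↔
                IsIdealTorsionΩ S Kc 𝓜 w e I.univ I.act (quotΩ y L) w.asIdeal P) ∧
          Function.Surjective c.left.base ∧
          -- (r3) polarisations: `q^* λ_B = p • λ_y`, `c^* λ_B = p • λ_y″`
          q ≫ lamB ≫ Literature.AlgebraicGeometry.AbelianSchemes.AbelianSchemeOver.DualPair.dualIsogenyOver q (dualΩOf S Kc 𝓜 w e I.univ I.dual y) DB =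
            (polΩOf S Kc 𝓜 w e I.univ I.pol y).lam ≫ (dualΩOf S Kc 𝓜 w e I.univ I.dual y).hat.mulN I.pChar ∧
          c ≫ lamB ≫ Literature.AlgebraicGeometry.AbelianSchemes.AbelianSchemeOver.DualPair.dualIsogenyOver c (dualΩOf S Kc 𝓜 w e I.univ I.dual (quotΩ y L)) DB =
            (polΩOf S Kc 𝓜 w e I.univ I.pol (quotΩ y L)).lam ≫ (dualΩOf S Kc 𝓜 w e I.univ I.dual (quotΩ y L)).hat.mulN I.pChar ∧
          -- (r4) `𝒪_F`-equivariance through a common endomorphism of `B`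
          (∀ a : 𝓞 F, ∃ b : B.X ⟶ B.X,
              (actΩOf S Kc 𝓜 w e I.univ I.act a y).hom.hom.hom ≫ q = q ≫ b ∧ (actΩOf S Kc 𝓜 w e I.univ I.act a (quotΩ y L)).hom.hom.hom ≫ c = c ≫ b) ∧
          -- (r5) level-`N` points correspond
          (∀ a : Fin I.g ⊕ Fin I.g → ZMod I.N,
              (AlgPoints.map q (lvlPtΩOf S Kc 𝓜 w e I.univ I.lvl y a) : B.toAffine.toAbelianVariety.Points (AlgebraicClosure (w.adicCompletion F))) =
                AlgPoints.map c (lvlPtΩOf S Kc 𝓜 w e I.univ I.lvl (quotΩ y L) a)) ∧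
          ∃ (qbar : ((I.univ.baseChange (pullback.fst (𝓜.localise w).total.hom (specResidueField w))).baseChange (red₀Of S Kc 𝓜 w h𝓨 e y).left).X ⟶
                     (((serreTensor I.act E' hE').baseChange (pullback.fst (𝓜.localise w).total.hom (specResidueField w))).baseChange (red₀Of S Kc 𝓜 w h𝓨 e (quotΩ y L)).left).X)
            (_ : IsMonHom qbar),
            (Flat qbar.left ∧ Function.Surjective qbar.left.base) ∧
            (∀ a : 𝓞 F, ((I.act.baseChange (pullback.fst (𝓜.localise w).total.hom (specResidueField w))).baseChange (red₀Of S Kc 𝓜 w h𝓨 e y).left).i a ≫ qbar =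
              qbar ≫ (((serreAction I.act E' hE').baseChange (pullback.fst (𝓜.localise w).total.hom (specResidueField w))).baseChange (red₀Of S Kc 𝓜 w h𝓨 e (quotΩ y L)).left).i a) ∧
            (∀ a : Fin I.g ⊕ Fin I.g → ZMod I.N,
              AlgPoints.map qbar ((I.univ.baseChange (pullback.fst (𝓜.localise w).total.hom (specResidueField w))).restrictPt (red₀Of S Kc 𝓜 w h𝓨 e y).left
                  (I.univ.sectionBaseChange (pullback.fst (𝓜.localise w).total.hom (specResidueField w)) (I.lvl.section_ a))) =
                ((serreTensor I.act E' hE').baseChange (pullback.fst (𝓜.localise w).total.hom (specResidueField w))).restrictPt (red₀Of S Kc 𝓜 w h𝓨 e (quotΩ y L)).left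
                  ((serreTensor I.act E' hE').sectionBaseChange (pullback.fst (𝓜.localise w).total.hom (specResidueField w)) (I.lvl.section_ a ≫ serreTranslate I.act E' hE' P))) ∧
            (∀ (DBs : (((serreTensor I.act E' hE').baseChange (pullback.fst (𝓜.localise w).total.hom (specResidueField w))).baseChange (red₀Of S Kc 𝓜 w h𝓨 e (quotΩ y L)).left).DualPair)
              (_ : Nonempty ((Scheme.Modules.pullback (DualPair.unitHatSlice DBs)).obj DBs.P ≅ SheafOfModules.unit _))
              (lamBs : (((serreTensor I.act E' hE').baseChange (pullback.fst (𝓜.localise w).total.hom (specResidueField w))).baseChange (red₀Of S Kc 𝓜 w h𝓨 e (quotΩ y L)).left).X ⟶ DBs.hat.X) [IsMonHom lamBs],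
              (haveI := isMonHom_coverLeg (pullback.fst (𝓜.localise w).total.hom (specResidueField w)) (red₀Of S Kc 𝓜 w h𝓨 e (quotΩ y L)).left I.act E' hE' P
               baseChangeHom (baseChangeHom (serreTranslate I.act E' hE' P) (pullback.fst (𝓜.localise w).total.hom (specResidueField w))) (red₀Of S Kc 𝓜 w h𝓨 e (quotΩ y L)).left ≫ lamBs ≫
                  DualPair.dualIsogenyOver (baseChangeHom (baseChangeHom (serreTranslate I.act E' hE' P) (pullback.fst (𝓜.localise w).total.hom (specResidueField w))) (red₀Of S Kc 𝓜 w h𝓨 e (quotΩ y L)).left) ((I.dual.baseChange (pullback.fst (𝓜.localise w).total.hom (specResidueField w))).baseChange (red₀Of S Kc 𝓜 w h𝓨 e (quotΩ y L)).left) DBs =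
                ((I.pol.baseChange (pullback.fst (𝓜.localise w).total.hom (specResidueField w))).baseChange (red₀Of S Kc 𝓜 w h𝓨 e (quotΩ y L)).left).lam ≫ ((I.dual.baseChange (pullback.fst (𝓜.localise w).total.hom (specResidueField w))).baseChange (red₀Of S Kc 𝓜 w h𝓨 e (quotΩ y L)).left).hat.mulN I.pChar) →
              qbar ≫ lamBs ≫ DualPair.dualIsogenyOver qbar ((I.dual.baseChange (pullback.fst (𝓜.localise w).total.hom (specResidueField w))).baseChange (red₀Of S Kc 𝓜 w h𝓨 e y).left) DBs =
                ((I.pol.baseChange (pullback.fst (𝓜.localise w).total.hom (specResidueField w))).baseChange (red₀Of S Kc 𝓜 w h𝓨 e y).left).lam ≫ ((I.dual.baseChange (pullback.fst (𝓜.localise w).total.hom (specResidueField w))).baseChange (red₀Of S Kc 𝓜 w h𝓨 e y).left).hat.mulN I.pChar) ∧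
            -- (K3₀) model KILL along a flat `𝒦 ↪ I.univ_ỹ` over `R = 𝒪_Ω̄` (`ỹ := extendPoint … (ℓ_e y)` the `R`-point extending `y` = LS `liftOf`): if `𝒦_η`, read in `A_y` through ★ (d5)'s three-piece
            -- isomorphism (= LS `isoGenericOf` by `hσΩ`), is killed by the LEG `q`, then `𝒦_s`, read in `sch₀Of … (red₀ y)` (= LS `isoSpecialOf` by `hσκ`), is killed by `q̄` — EXACTLY (KEW) `…_of_kerRow`'s `hK3`
            (∀ (𝒦 : Over (Spec (.of (closureValuationSubring (w.adicCompletion F))))) (incl : 𝒦 ⟶ (I.univ.baseChange (extendPoint (closureValuationSubring (w.adicCompletion F)) (toClosureValuationSubring w) (𝓜.localise w).total ((𝓜.localise w).modelPointsEquiv.symm (thickeningLift e (S.M.obj Kc) y))).left).X) [Flat 𝒦.hom],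
              ((Over.pullback (specFractionFieldι (closureValuationSubring (w.adicCompletion F)) (toClosureValuationSubring w)).left).map incl ≫
                  (I.univ.fibreBaseChangeIso ((𝓜.localise w).genericIso'.inv.left ≫ pullback.fst (𝓜.localise w).total.hom (specGenericPoint (HeightOneSpectrum.valuationSubringAtPrime F w) F)) (thickeningLift e (S.M.obj Kc) y).left ≪≫ I.univ.fibreCongrPtIso ((𝓜.localise w).left_specFractionFieldι_comp_extendPoint_modelPointsEquiv_symm (thickeningLift e (S.M.obj Kc) y)).symm ≪≫ (I.univ.fibreBaseChangeIso (extendPoint (closureValuationSubring (w.adicCompletion F)) (toClosureValuationSubring w) (𝓜.localise w).total ((𝓜.localise w).modelPointsEquiv.symm (thickeningLift e (S.M.obj Kc) y))).left (specFractionFieldι (closureValuationSubring (w.adicCompletion F)) (toClosureValuationSubring w)).left).symm).inv.hom.hom.hom) ≫ q = 1 →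
              ((Over.pullback ((geomClosedPointIsoSpecResidueField w).inv.left ≫ (specRingHomι (closureValuationSubring (w.adicCompletion F)) (toClosureValuationSubring w) (IsLocalRing.residue (closureValuationSubring (w.adicCompletion F)))).left)).map incl ≫
                  (I.univ.fibreBaseChangeIso (pullback.fst (𝓜.localise w).total.hom (specResidueField w)) ((𝓜.localise w).geomReductionMap (thickeningLift e (S.M.obj Kc) y)).left ≪≫ I.univ.fibreCongrPtIso (((𝓜.localise w).left_geomReductionMap_comp_fst (thickeningLift e (S.M.obj Kc) y)).trans (Category.assoc _ _ _).symm) ≪≫ (I.univ.fibreBaseChangeIso (extendPoint (closureValuationSubring (w.adicCompletion F)) (toClosureValuationSubring w) (𝓜.localise w).total ((𝓜.localise w).modelPointsEquiv.symm (thickeningLift e (S.M.obj Kc) y))).left ((geomClosedPointIsoSpecResidueField w).inv.left ≫ (specRingHomι (closureValuationSubring (w.adicCompletion F)) (toClosureValuationSubring w) (IsLocalRing.residue (closureValuationSubring (w.adicCompletion F)))).left)).symm).inv.hom.hom.hom) ≫ qbar = 1) ∧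
            -- (K2₀) for every ideal `𝔞`: `Ker q(Ω̄) ⊆ A_y[𝔞](Ω̄)` on points ⇒ `Ker q̄ ⊆ A_{red₀ y}[𝔞]` on ALL `T`-points (★ currency; `IsIdealTorsionΩ … y 𝔞 Pt` and
            -- `(act₀Of 𝓜 w I.univ I.act r (red₀Of … y)).hom.hom.hom` unfold to the two `.i r` terms by `actΩOf_hom_hom_hom` ∕ `act₀Of_hom_hom_hom` (rfl)); at `𝔞 := 𝔭_w·𝔭_{c•w}` = W3∕W5's `hker`
            (∀ 𝔞 : Ideal (𝓞 F),
              (∀ Pt : ((I.univ.baseChange ((𝓜.localise w).genericIso'.inv.left ≫ pullback.fst (𝓜.localise w).total.hom (specGenericPoint (HeightOneSpectrum.valuationSubringAtPrime F w) F))).baseChange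
                  (thickeningLift e (S.M.obj Kc) y).left).toAffine.toAbelianVariety.Points (AlgebraicClosure (w.adicCompletion F)),
                (AlgPoints.map q Pt : B.toAffine.toAbelianVariety.Points (AlgebraicClosure (w.adicCompletion F))) = 1 →
                  ∀ r ∈ 𝔞, (AlgPoints.map (((I.act.baseChange ((𝓜.localise w).genericIso'.inv.left ≫ pullback.fst (𝓜.localise w).total.hom (specGenericPoint (HeightOneSpectrum.valuationSubringAtPrime F w) F))).baseChange (thickeningLift e (S.M.obj Kc) y).left).i r) Pt :
                    ((I.univ.baseChange ((𝓜.localise w).genericIso'.inv.left ≫ pullback.fst (𝓜.localise w).total.hom (specGenericPoint (HeightOneSpectrum.valuationSubringAtPrime F w) F))).baseChange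
                      (thickeningLift e (S.M.obj Kc) y).left).toAffine.toAbelianVariety.Points (AlgebraicClosure (w.adicCompletion F))) = 1) →
              ∀ ⦃T : Over (Spec (.of (geomResidueField w)))⦄ (z : T ⟶ ((I.univ.baseChange (pullback.fst (𝓜.localise w).total.hom (specResidueField w))).baseChange (red₀Of S Kc 𝓜 w h𝓨 e y).left).X),
                z ≫ qbar = 1 → ∀ r ∈ 𝔞, z ≫ ((I.act.baseChange (pullback.fst (𝓜.localise w).total.hom (specResidueField w))).baseChange (red₀Of S Kc 𝓜 w h𝓨 e y).left).i r = 1) ∧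
            -- (K4₀) degree, (FIN₀) finiteness, (RK₀) `rk Γ(Ker q̄) = #Ker q(Ω̄)` of the reduced leg
            Literature.AlgebraicGeometry.Motives.AbelianVariety.Hom.kerRank (homOfIsMonHom qbar) = Literature.AlgebraicGeometry.Motives.AbelianVariety.Hom.kerRank (homOfIsMonHom q) ∧
            IsFinite qbar.left ∧
            Module.finrank (geomResidueField w) (Literature.AlgebraicGeometry.GroupSchemes.AffineGroupScheme.Alg (Literature.AlgebraicGeometry.GroupSchemes.GroupSchemeKernel.ker qbar)) =
              Nat.card (Literature.AlgebraicGeometry.Motives.AbelianVariety.Hom.kerPoints (specOver (AlgebraicClosure (w.adicCompletion F)) (AlgebraicClosure (w.adicCompletion F))) (homOfIsMonHom q)) := by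
  haveI := I.comm
  intro y L
  exact (hroof y L).elim fun K hK => ⟨K, hK.1, exists_roofLeg_of_roofΩ_kerRows I E' hE' P Q hP hQ hQP hPQ h𝔭 hD y (quotΩ y L) K hK.2⟩

end KernelRows

end Summit.HodgeConjecture.HodgeConjecture.Cruxes.HLiu418.F0P6aStubFROBRoofLegs

end
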